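import Summits.Langlands.Langlands.Theses.ParityBlindBianchi
import Summits.Langlands.Langlands.Theorems.ParityBlindBianchiEvenArtinJunction
import Summits.Langlands.Langlands.Theorems.ParityBlindBianchiEvenArtinJunctionSummitImpliesTarget
import HarnessLib

/-!
# STRATEGY CENSUS (typed part) — crux stmt-Langlands-2908 `ParityBlindBianchi.EvenArtinJunction`
(crux-strategist planner-cstrat-stmt-Langlands-2908-s1-0, 2026-08-17; companion of STRATEGY-CENSUS.md)

Kernel-checked signatures for the census headings.  `J := EvenArtinJunction = (X → Langlands)`,
`X := EvenIcosahedralStrongArtin`.  Nothing here asserts `J`; 0 sorries.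

* `## Strengthen`: `S⁺ := Langlands` (`junction_of_summit`); the inductive shape `LanglandsUpTo N` and why
  `(∀ N, LanglandsUpTo N) → Langlands` is NOT formal (the datum `𝓡` is chosen after `N`): `langlandsUpTo_of_langlands`
  is the only provable direction.
* `## Decomposition` D-AB: `DirectionAExists` (J₁) and `FontaineMazurGivenA` (J₂) with the PROVED seam
  `langlands_of_dirA_of_FM : J₁ → J₂ → Langlands` and `junction_of_dirA_of_FM : J₁ → J₂ → J` — `X` is idle
  (`_hX` unused), which is the census's point: every typed split of `J` is a split of the summit followed by weakening.
* `## Negation`: `not_junction_iff` (landed p137220) — a counterexample to `J` is `X ∧ ¬Langlands`; and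
  `junction_of_not_target : ¬X → J`, the branch the registered line `Lines/dedekind-exclusion.lean` runs.
-/

noncomputable section

set_option linter.dupNamespace false

open Literature.NumberTheory.Automorphic
open Summit.Langlands Summit.Langlands.Langlands.Theses Summit.Langlands.Langlands.Theses.ParityBlindBianchi

namespace Summit.Langlands.Langlands.Cruxes.EvenArtinJunction.StrategyCensus

/-! ## Strengthen -/

/-- `S⁺ := Langlands` implies the junction (discard `X`). [folklore] -/
theorem junction_of_summit (h : _root_.Langlands) : EvenArtinJunction := fun _ => h

/-- The inductive shape `Langlands up to rank N`: the summit's body with `n ≤ N` added (the reciprocity datum `𝓡`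
is still chosen once per field, BEFORE `n`, but AFTER `N`). [cite: BuzzardGeeLMS2014, Conj. 3.2.2] -/
def LanglandsUpTo (N : ℕ) : Prop :=
  ∀ (F : Type) [Field F] [NumberField F], ∃ 𝓡 : ReciprocityData F,
    ∀ n : ℕ, 0 < n → n ≤ N →
      ∀ hcpt : isCompact_glFiniteIntegralLevel n F, GlobalLanglandsCorrespondenceGLn n F 𝓡 hcpt

/-- `Langlands → LanglandsUpTo N` for every `N` (projection).  The converse `(∀ N, LanglandsUpTo N) → Langlands` is
NOT provable formally: the witnesses `𝓡_N` may depend on `N`; commuting `∀ N` with `∃ 𝓡` needs UNIQUENESS of the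
local Langlands datum (Henniart's characterisation by `ε`-factors of pairs) — the one place where added rigidity
buys an inductive SHAPE, and nothing for the inductive STEP (census `## Strengthen`). [folklore] -/
theorem langlandsUpTo_of_langlands (h : _root_.Langlands) (N : ℕ) : LanglandsUpTo N := by
  intro F _ _
  obtain ⟨𝓡, h𝓡⟩ := h F
  exact ⟨𝓡, fun n hn _ hcpt => h𝓡 n hn hcpt⟩

/-! ## Decomposition D-AB: direction (A) with its datum, then Fontaine–Mazur given (A) -/

/-- J₁ — **direction (A) with the reciprocity datum**: for every number field there are reciprocity data `𝓡`
carrying `AutomorphicToGalois` in every rank (Galois representations attached to ALL L-algebraic cuspidal `π`, with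
local–global compatibility at every finite place; the irregular sector is the open core —
`Literature.Barriers.Langlands.NonRegularWeightBarrier`, `ShimuraVarietyRealizationBarrier`, `ShtukaConstantFieldBarrier`).
[cite: BuzzardGeeLMS2014, Conj. 3.2.1 and Conj. 3.2.2] -/
def DirectionAExists : Prop :=
  ∀ (F : Type) [Field F] [NumberField F], ∃ 𝓡 : ReciprocityData F,
    ∀ n : ℕ, 0 < n → ∀ hcpt : isCompact_glFiniteIntegralLevel n F, AutomorphicToGalois n 𝓡 hcpt

/-- J₂ — **Fontaine–Mazur–Langlands given (A) at the same datum**: whenever `𝓡` carries (A) in every rank, every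
irreducible `𝓡`-geometric `ρ` is cuspidal automorphic with full `Corresponds` (modularity-lifting / potential-automorphy
world; `TaylorWilesNumericalCoincidence`, `TwistedEndoscopySelfDual`, `ResiduallyReducibleBarrier`, `SolvableImageBarrier`,
`PatchingLocalComponentBarrier`, `ModPLanglandsGL2BeyondQp` all live here). [cite: FontaineMazurGeometric1995, Conj. 1] -/
def FontaineMazurGivenA : Prop :=
  ∀ (F : Type) [Field F] [NumberField F] (𝓡 : ReciprocityData F),
    (∀ n : ℕ, 0 < n → ∀ hcpt : isCompact_glFiniteIntegralLevel n F, AutomorphicToGalois n 𝓡 hcpt) →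
      ∀ n : ℕ, 0 < n → ∀ hcpt : isCompact_glFiniteIntegralLevel n F, GaloisToAutomorphic n 𝓡 hcpt

/-- The seam of D-AB is modus ponens: `J₁ → J₂ → Langlands`. [folklore] -/
theorem langlands_of_dirA_of_FM (hA : DirectionAExists) (hB : FontaineMazurGivenA) : _root_.Langlands := by
  intro F _ _
  obtain ⟨𝓡, h𝓡⟩ := hA F
  exact ⟨𝓡, fun n hn hcpt => ⟨h𝓡 n hn hcpt, hB F 𝓡 h𝓡 n hn hcpt⟩⟩

/-- … hence `J₁ → J₂ → J`, with the antecedent `X` UNUSED — the typed form of the census verdict "every decomposition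
of the junction is a decomposition of the summit followed by the weakening `L → (X → L)`". [folklore] -/
theorem junction_of_dirA_of_FM (hA : DirectionAExists) (hB : FontaineMazurGivenA) : EvenArtinJunction :=
  fun _hX => langlands_of_dirA_of_FM hA hB

/-- Converse bookkeeping: `Langlands → J₁` (projection). (`Langlands → J₂` is NOT formal: it needs uniqueness of the
datum / transport of `Corresponds` along conjugate `ρ`, i.e. Chebotarev + Brauer–Nesbitt — LiftDescend's open support
item `WeakToStrongGalToAut` territory.) [folklore] -/
theorem dirA_of_langlands (h : _root_.Langlands) : DirectionAExists := by
  intro F _ _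
  obtain ⟨𝓡, h𝓡⟩ := h F
  exact ⟨𝓡, fun n hn hcpt => (h𝓡 n hn hcpt).1⟩

/-! ## Negation -/

/-- A counterexample to the junction is exactly `X ∧ ¬Langlands` (landed p137220, restated by name). [folklore] -/
theorem not_junction_iff : ¬ EvenArtinJunction ↔ (EvenIcosahedralStrongArtin ∧ ¬ _root_.Langlands) :=
  Summit.Langlands.Langlands.Theorems.parityBlindBianchi_not_evenArtinJunction_iff

/-- The `¬X` branch: a refutation of the route TARGET proves the junction (the branch run by the registered line
`Lines/dedekind-exclusion.lean`, whose stubs derive `¬X` from the Dedekind bet C1). [folklore] -/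
theorem junction_of_not_target (h : ¬ EvenIcosahedralStrongArtin) : EvenArtinJunction :=
  fun hX => absurd hX h

/-- Exact position, by name (landed p140157): `J ↔ (X ↔ Langlands)`. [folklore] -/
theorem junction_iff_target_iff_summit : EvenArtinJunction ↔ (EvenIcosahedralStrongArtin ↔ _root_.Langlands) :=
  Summit.Langlands.Langlands.Theorems.parityBlindBianchi_evenArtinJunction_iff_target_iff_summit

end Summit.Langlands.Langlands.Cruxes.EvenArtinJunction.StrategyCensus

end
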